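import Literature.Analysis.FunctionSpaces.PolchinskiCb2Calculus
import Mathlib.Analysis.SpecialFunctions.Pow.Real
import HarnessLib

/-!
# Weighted `C²` calculus relative to a positive weight `Z`: "jet" and "tame" size classes
# (bookkeeping for the derivatives of `e^{−V_t}Φ(P_{0,t}F)` and `e^{−V_t}(∇√P_{0,t}F)²_{Ċ_t}` when the
# initial potential of Bauerschmidt–Bodineau–Dagallier's Theorem 3 is unbounded above)

Topic `Literature/Analysis/FunctionSpaces`; "proof architecture" file behind the named fact
`Polchinski.BauerschmidtBodineau_multiscaleBakryEmery` ([BBD] Theorem 3, `MultiscaleBakryEmery.lean`).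

`PolchinskiCb2Calculus.lean` assembles `C_b²` data for rational expressions in the smoothed jets
`Z = E_{C_t}[e^{−V₀}(·+ζ)]`, `W = E_{C_t}[e^{−V₀}F(·+ζ)]`, … using a POSITIVE LOWER BOUND `Z ≥ m` to invert.
For an initial potential that is only bounded below (the printed generality of [BBD] Thm 3 / [BB21] Thm 5),
`Z_t(y) → 0` at infinity and `P_{0,t}F = W/Z` has unbounded derivatives.  What persists
(`PolchinskiSmoothedPotential.lean`): every jet `J` satisfies `|J| ≤ c_δ Z^{1−δ}` for all `δ > 0`.
This file is the corresponding bookkeeping.  Relative to a weight `0 < Z ≤ K₀` a size function `σ` is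

* of JET size if `∀ δ > 0, ∃ c ≥ 0, σ ≤ c·Z^{1−δ}` (the atoms and their derivatives; such `σ` are bounded),
* of TAME size if `∀ δ > 0, ∃ c ≥ 0, σ ≤ c·Z^{−δ}` (quotients jet/`Z`: `P_{0,t}F`, its derivatives, …).

Jet·tame is jet, tame·tame is tame, jet/`Z` is tame, and `Z·`tame is jet, hence bounded: this is why the
`e^{−V_t}`-weighted families of [BBD]'s proof are `C_b²` although `P_{0,t}F` is not.  The second part lifts
this to functions with two Fréchet derivatives ("packs": `HasFDerivAt` chains with jet/tame sizes of
`f, Df, D²f`): sums, products, inverses of tame functions bounded below, the quotient jet/`Z`, composition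
with a `C_b²` scalar function, and the passage from bounded third-order data to uniform continuity.
(All predicates are spelled out; no definition is introduced.)

## Main results (sorry-free; no new definitions, no new named facts)

* size algebra: `tame_of_le_const`, `tame_add`, `tame_mul`, `tame_sum`, `jet_of_le_mul_weight`, `jet_add`,
  `jet_mul_tame`, `jet_sum`, `tame_of_jet`, `tame_of_jet_div`, `bounded_of_jet`, `exp_bound_of_tame`;
* packs: `tpack_add`, `tpack_sub`, `tpack_mul`, `jpack_add`, `jpack_mul_tpack`, `tpack_inv`,
  `tpack_of_jpack_div` (the quotient jet/`Z`), `tpack_comp` (composition with `Φ ∈ C_b²`), `tpack_const`;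
* `uniformContinuous_of_partials` — uniform continuity of a bilinear-map-valued `D²f` from Lipschitz
  matrix elements.

Nothing here concerns Yang–Mills.

## References

* [BauerschmidtBodineauDagallier2023] R. Bauerschmidt, T. Bodineau, B. Dagallier, Probab. Surveys 21
  (2024) 200–290, arXiv:2307.07619 — proof of Theorem 3 p0016, Lemma 1 p0017 (product/quotient rules
  for `P_{0,t}F = W/Z`). READ (held text).
* [Rudin1976] W. Rudin, Principles of Mathematical Analysis — Thm 5.3 (product/quotient rules), 9.19.
-/

noncomputable section

-- nested operator-norm instances `E →L[ℝ] E →L[ℝ] ℝ`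
set_option maxSynthPendingDepth 3

open Filter Topology Set

namespace Literature.Analysis.FunctionSpaces

namespace Polchinski

/-! ### 1. Size algebra relative to a weight `0 < Z ≤ K₀` -/

section Size

variable {α : Type*} {Z : α → ℝ} {K₀ : ℝ}

/-- `Z^{a} Z^{b} = Z^{a+b}`. [folklore] -/
private theorem weight_rpow_add (hZ : ∀ a, 0 < Z a) (a : α) (p q : ℝ) :
    Z a ^ p * Z a ^ q = Z a ^ (p + q) :=
  (Real.rpow_add (hZ a) p q).symm

/-- `(|K₀|+1)^{−δ} ≤ Z^{−δ}` for `δ ≥ 0`. [folklore] -/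
private theorem rpow_K₁_le (hZ : ∀ a, 0 < Z a) (hZK : ∀ a, Z a ≤ K₀) (a : α) {δ : ℝ} (hδ : 0 ≤ δ) :
    (|K₀| + 1) ^ (-δ) ≤ Z a ^ (-δ) :=
  Real.rpow_le_rpow_of_nonpos (hZ a) ((hZK a).trans ((le_abs_self K₀).trans (by linarith)))
    (by linarith)

/-- Monotonicity of the tame class. [cite: BauerschmidtBodineauDagallier2023, Theorem 3 (proof)] -/
theorem tame_mono {σ σ₁ : α → ℝ}
    (h1 : ∀ δ : ℝ, 0 < δ → ∃ c : ℝ, 0 ≤ c ∧ ∀ a, σ₁ a ≤ c * Z a ^ (-δ)) (h : ∀ a, σ a ≤ σ₁ a) :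
    ∀ δ : ℝ, 0 < δ → ∃ c : ℝ, 0 ≤ c ∧ ∀ a, σ a ≤ c * Z a ^ (-δ) := by
  intro δ hδ
  obtain ⟨c, hc, h1⟩ := h1 δ hδ
  exact ⟨c, hc, fun a => (h a).trans (h1 a)⟩

/-- Monotonicity of the jet class. [cite: BauerschmidtBodineauDagallier2023, Theorem 3 (proof)] -/
theorem jet_mono {σ σ₁ : α → ℝ}
    (h1 : ∀ δ : ℝ, 0 < δ → ∃ c : ℝ, 0 ≤ c ∧ ∀ a, σ₁ a ≤ c * Z a ^ (1 - δ)) (h : ∀ a, σ a ≤ σ₁ a) :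
    ∀ δ : ℝ, 0 < δ → ∃ c : ℝ, 0 ≤ c ∧ ∀ a, σ a ≤ c * Z a ^ (1 - δ) := by
  intro δ hδ
  obtain ⟨c, hc, h1⟩ := h1 δ hδ
  exact ⟨c, hc, fun a => (h a).trans (h1 a)⟩

/-- A bounded size is tame: `σ ≤ B ⟹ σ ≤ (max B 0)(|K₀|+1)^δ · Z^{−δ}`. [cite: BauerschmidtBodineauDagallier2023, Theorem 3 (proof)] -/
theorem tame_of_le_const (hZ : ∀ a, 0 < Z a) (hZK : ∀ a, Z a ≤ K₀) {σ : α → ℝ} {B : ℝ}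
    (hB : ∀ a, σ a ≤ B) :
    ∀ δ : ℝ, 0 < δ → ∃ c : ℝ, 0 ≤ c ∧ ∀ a, σ a ≤ c * Z a ^ (-δ) := by
  intro δ hδ
  have hK1 : (0 : ℝ) < |K₀| + 1 := by positivity
  refine ⟨max B 0 * (|K₀| + 1) ^ δ, by positivity, fun a => ?_⟩
  have h1 : (1 : ℝ) ≤ (|K₀| + 1) ^ δ * Z a ^ (-δ) := by
    have h := rpow_K₁_le hZ hZK a hδ.le
    have hK0 : (|K₀| + 1) ^ δ * (|K₀| + 1) ^ (-δ) = 1 := by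
      rw [← Real.rpow_add hK1, add_neg_cancel, Real.rpow_zero]
    calc (1 : ℝ) = (|K₀| + 1) ^ δ * (|K₀| + 1) ^ (-δ) := hK0.symm
      _ ≤ (|K₀| + 1) ^ δ * Z a ^ (-δ) := mul_le_mul_of_nonneg_left h (Real.rpow_nonneg hK1.le _)
  calc σ a ≤ max B 0 := (hB a).trans (le_max_left _ _)
    _ ≤ max B 0 * ((|K₀| + 1) ^ δ * Z a ^ (-δ)) := le_mul_of_one_le_right (le_max_right _ _) h1
    _ = max B 0 * (|K₀| + 1) ^ δ * Z a ^ (-δ) := by ring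

/-- Tame sizes are closed under domination by a sum. [cite: BauerschmidtBodineauDagallier2023, Theorem 3 (proof)] -/
theorem tame_add {σ σ₁ σ₂ : α → ℝ}
    (h1 : ∀ δ : ℝ, 0 < δ → ∃ c : ℝ, 0 ≤ c ∧ ∀ a, σ₁ a ≤ c * Z a ^ (-δ))
    (h2 : ∀ δ : ℝ, 0 < δ → ∃ c : ℝ, 0 ≤ c ∧ ∀ a, σ₂ a ≤ c * Z a ^ (-δ))
    (h : ∀ a, σ a ≤ σ₁ a + σ₂ a) :
    ∀ δ : ℝ, 0 < δ → ∃ c : ℝ, 0 ≤ c ∧ ∀ a, σ a ≤ c * Z a ^ (-δ) := by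
  intro δ hδ
  obtain ⟨c₁, hc₁, h1⟩ := h1 δ hδ
  obtain ⟨c₂, hc₂, h2⟩ := h2 δ hδ
  refine ⟨c₁ + c₂, by positivity, fun a => (h a).trans ?_⟩
  rw [add_mul]
  exact add_le_add (h1 a) (h2 a)

/-- Tame sizes are closed under domination by a product (first factor nonnegative). [cite: BauerschmidtBodineauDagallier2023, Theorem 3 (proof)] -/
theorem tame_mul (hZ : ∀ a, 0 < Z a) {σ σ₁ σ₂ : α → ℝ}
    (h1 : ∀ δ : ℝ, 0 < δ → ∃ c : ℝ, 0 ≤ c ∧ ∀ a, σ₁ a ≤ c * Z a ^ (-δ))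
    (h2 : ∀ δ : ℝ, 0 < δ → ∃ c : ℝ, 0 ≤ c ∧ ∀ a, σ₂ a ≤ c * Z a ^ (-δ))
    (h10 : ∀ a, 0 ≤ σ₁ a) (h : ∀ a, σ a ≤ σ₁ a * σ₂ a) :
    ∀ δ : ℝ, 0 < δ → ∃ c : ℝ, 0 ≤ c ∧ ∀ a, σ a ≤ c * Z a ^ (-δ) := by
  intro δ hδ
  obtain ⟨c₁, hc₁, h1⟩ := h1 (δ / 2) (half_pos hδ)
  obtain ⟨c₂, hc₂, h2⟩ := h2 (δ / 2) (half_pos hδ)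
  refine ⟨c₁ * c₂, by positivity, fun a => (h a).trans ?_⟩
  have hz := Real.rpow_nonneg (hZ a).le (-(δ / 2))
  calc σ₁ a * σ₂ a ≤ σ₁ a * (c₂ * Z a ^ (-(δ / 2))) := mul_le_mul_of_nonneg_left (h2 a) (h10 a)
    _ ≤ (c₁ * Z a ^ (-(δ / 2))) * (c₂ * Z a ^ (-(δ / 2))) :=
        mul_le_mul_of_nonneg_right (h1 a) (mul_nonneg hc₂ hz)
    _ = c₁ * c₂ * (Z a ^ (-(δ / 2)) * Z a ^ (-(δ / 2))) := by ring
    _ = c₁ * c₂ * Z a ^ (-δ) := by rw [weight_rpow_add hZ]; ring_nf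

/-- Finite sums of tame sizes are tame. [cite: BauerschmidtBodineauDagallier2023, Theorem 3 (proof)] -/
theorem tame_sum {ι : Type*} (S : Finset ι) {σ : ι → α → ℝ}
    (h : ∀ i ∈ S, ∀ δ : ℝ, 0 < δ → ∃ c : ℝ, 0 ≤ c ∧ ∀ a, σ i a ≤ c * Z a ^ (-δ)) :
    ∀ δ : ℝ, 0 < δ → ∃ c : ℝ, 0 ≤ c ∧ ∀ a, (∑ i ∈ S, σ i a) ≤ c * Z a ^ (-δ) := by
  classical
  induction S using Finset.induction_on with
  | empty =>
    intro δ hδ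
    exact ⟨0, le_rfl, fun a => by simp⟩
  | insert i S hi ih =>
    intro δ hδ
    obtain ⟨c₁, hc₁, h1⟩ := h i (Finset.mem_insert_self i S) δ hδ
    obtain ⟨c₂, hc₂, h2⟩ := ih (fun j hj => h j (Finset.mem_insert_of_mem hj)) δ hδ
    refine ⟨c₁ + c₂, by positivity, fun a => ?_⟩
    rw [Finset.sum_insert hi, add_mul]
    exact add_le_add (h1 a) (h2 a)

/-- A size dominated by a multiple of the weight is of jet size:
`σ ≤ B·Z ⟹ σ ≤ (max B 0)(|K₀|+1)^δ Z^{1−δ}`. [cite: BauerschmidtBodineauDagallier2023, Theorem 3 (proof)] -/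
theorem jet_of_le_mul_weight (hZ : ∀ a, 0 < Z a) (hZK : ∀ a, Z a ≤ K₀) {σ : α → ℝ} {B : ℝ}
    (hB : ∀ a, σ a ≤ B * Z a) :
    ∀ δ : ℝ, 0 < δ → ∃ c : ℝ, 0 ≤ c ∧ ∀ a, σ a ≤ c * Z a ^ (1 - δ) := by
  intro δ hδ
  have hK1 : (0 : ℝ) < |K₀| + 1 := by positivity
  refine ⟨max B 0 * (|K₀| + 1) ^ δ, by positivity, fun a => ?_⟩
  have hza := hZ a
  have hK : Z a ≤ |K₀| + 1 := (hZK a).trans ((le_abs_self K₀).trans (by linarith))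
  have hsplit : Z a = Z a ^ (1 - δ) * Z a ^ δ := by
    rw [weight_rpow_add hZ]; ring_nf; rw [Real.rpow_one]
  calc σ a ≤ B * Z a := hB a
    _ ≤ max B 0 * Z a := mul_le_mul_of_nonneg_right (le_max_left _ _) hza.le
    _ = max B 0 * (Z a ^ (1 - δ) * Z a ^ δ) := by rw [← hsplit]
    _ ≤ max B 0 * (Z a ^ (1 - δ) * (|K₀| + 1) ^ δ) := by
        refine mul_le_mul_of_nonneg_left ?_ (le_max_right _ _)
        exact mul_le_mul_of_nonneg_left (Real.rpow_le_rpow hza.le hK hδ.le)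
          (Real.rpow_nonneg hza.le _)
    _ = max B 0 * (|K₀| + 1) ^ δ * Z a ^ (1 - δ) := by ring

/-- Jet sizes are closed under domination by a sum. [cite: BauerschmidtBodineauDagallier2023, Theorem 3 (proof)] -/
theorem jet_add {σ σ₁ σ₂ : α → ℝ}
    (h1 : ∀ δ : ℝ, 0 < δ → ∃ c : ℝ, 0 ≤ c ∧ ∀ a, σ₁ a ≤ c * Z a ^ (1 - δ))
    (h2 : ∀ δ : ℝ, 0 < δ → ∃ c : ℝ, 0 ≤ c ∧ ∀ a, σ₂ a ≤ c * Z a ^ (1 - δ))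
    (h : ∀ a, σ a ≤ σ₁ a + σ₂ a) :
    ∀ δ : ℝ, 0 < δ → ∃ c : ℝ, 0 ≤ c ∧ ∀ a, σ a ≤ c * Z a ^ (1 - δ) := by
  intro δ hδ
  obtain ⟨c₁, hc₁, h1⟩ := h1 δ hδ
  obtain ⟨c₂, hc₂, h2⟩ := h2 δ hδ
  refine ⟨c₁ + c₂, by positivity, fun a => (h a).trans ?_⟩
  rw [add_mul]
  exact add_le_add (h1 a) (h2 a)

/-- Finite sums of jet sizes are of jet size. [cite: BauerschmidtBodineauDagallier2023, Theorem 3 (proof)] -/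
theorem jet_sum {ι : Type*} (S : Finset ι) {σ : ι → α → ℝ}
    (h : ∀ i ∈ S, ∀ δ : ℝ, 0 < δ → ∃ c : ℝ, 0 ≤ c ∧ ∀ a, σ i a ≤ c * Z a ^ (1 - δ)) :
    ∀ δ : ℝ, 0 < δ → ∃ c : ℝ, 0 ≤ c ∧ ∀ a, (∑ i ∈ S, σ i a) ≤ c * Z a ^ (1 - δ) := by
  classical
  induction S using Finset.induction_on with
  | empty =>
    intro δ hδ
    exact ⟨0, le_rfl, fun a => by simp⟩
  | insert i S hi ih =>
    intro δ hδ
    obtain ⟨c₁, hc₁, h1⟩ := h i (Finset.mem_insert_self i S) δ hδ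
    obtain ⟨c₂, hc₂, h2⟩ := ih (fun j hj => h j (Finset.mem_insert_of_mem hj)) δ hδ
    refine ⟨c₁ + c₂, by positivity, fun a => ?_⟩
    rw [Finset.sum_insert hi, add_mul]
    exact add_le_add (h1 a) (h2 a)

/-- Jet · tame is jet (first factor nonnegative). [cite: BauerschmidtBodineauDagallier2023, Theorem 3 (proof)] -/
theorem jet_mul_tame (hZ : ∀ a, 0 < Z a) {σ σ₁ σ₂ : α → ℝ}
    (h1 : ∀ δ : ℝ, 0 < δ → ∃ c : ℝ, 0 ≤ c ∧ ∀ a, σ₁ a ≤ c * Z a ^ (1 - δ))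
    (h2 : ∀ δ : ℝ, 0 < δ → ∃ c : ℝ, 0 ≤ c ∧ ∀ a, σ₂ a ≤ c * Z a ^ (-δ))
    (h10 : ∀ a, 0 ≤ σ₁ a) (h : ∀ a, σ a ≤ σ₁ a * σ₂ a) :
    ∀ δ : ℝ, 0 < δ → ∃ c : ℝ, 0 ≤ c ∧ ∀ a, σ a ≤ c * Z a ^ (1 - δ) := by
  intro δ hδ
  obtain ⟨c₁, hc₁, h1⟩ := h1 (δ / 2) (half_pos hδ)
  obtain ⟨c₂, hc₂, h2⟩ := h2 (δ / 2) (half_pos hδ)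
  refine ⟨c₁ * c₂, by positivity, fun a => (h a).trans ?_⟩
  have hz := Real.rpow_nonneg (hZ a).le (-(δ / 2))
  calc σ₁ a * σ₂ a ≤ σ₁ a * (c₂ * Z a ^ (-(δ / 2))) := mul_le_mul_of_nonneg_left (h2 a) (h10 a)
    _ ≤ (c₁ * Z a ^ (1 - δ / 2)) * (c₂ * Z a ^ (-(δ / 2))) :=
        mul_le_mul_of_nonneg_right (h1 a) (mul_nonneg hc₂ hz)
    _ = c₁ * c₂ * (Z a ^ (1 - δ / 2) * Z a ^ (-(δ / 2))) := by ring
    _ = c₁ * c₂ * Z a ^ (1 - δ) := by rw [weight_rpow_add hZ]; ring_nf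

/-- Tame · jet is jet (first factor nonnegative). [cite: BauerschmidtBodineauDagallier2023, Theorem 3 (proof)] -/
theorem tame_mul_jet (hZ : ∀ a, 0 < Z a) {σ σ₁ σ₂ : α → ℝ}
    (h1 : ∀ δ : ℝ, 0 < δ → ∃ c : ℝ, 0 ≤ c ∧ ∀ a, σ₁ a ≤ c * Z a ^ (-δ))
    (h2 : ∀ δ : ℝ, 0 < δ → ∃ c : ℝ, 0 ≤ c ∧ ∀ a, σ₂ a ≤ c * Z a ^ (1 - δ))
    (h10 : ∀ a, 0 ≤ σ₁ a) (h : ∀ a, σ a ≤ σ₁ a * σ₂ a) :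
    ∀ δ : ℝ, 0 < δ → ∃ c : ℝ, 0 ≤ c ∧ ∀ a, σ a ≤ c * Z a ^ (1 - δ) := by
  intro δ hδ
  obtain ⟨c₁, hc₁, h1⟩ := h1 (δ / 2) (half_pos hδ)
  obtain ⟨c₂, hc₂, h2⟩ := h2 (δ / 2) (half_pos hδ)
  refine ⟨c₁ * c₂, by positivity, fun a => (h a).trans ?_⟩
  have hz := Real.rpow_nonneg (hZ a).le (1 - δ / 2)
  calc σ₁ a * σ₂ a ≤ σ₁ a * (c₂ * Z a ^ (1 - δ / 2)) := mul_le_mul_of_nonneg_left (h2 a) (h10 a)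
    _ ≤ (c₁ * Z a ^ (-(δ / 2))) * (c₂ * Z a ^ (1 - δ / 2)) :=
        mul_le_mul_of_nonneg_right (h1 a) (mul_nonneg hc₂ hz)
    _ = c₁ * c₂ * (Z a ^ (-(δ / 2)) * Z a ^ (1 - δ / 2)) := by ring
    _ = c₁ * c₂ * Z a ^ (1 - δ) := by rw [weight_rpow_add hZ]; ring_nf

/-- Jet sizes are tame (`Z^{1−δ} ≤ K₀ Z^{−δ}`). [cite: BauerschmidtBodineauDagallier2023, Theorem 3 (proof)] -/
theorem tame_of_jet (hZ : ∀ a, 0 < Z a) (hZK : ∀ a, Z a ≤ K₀) {σ : α → ℝ}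
    (h1 : ∀ δ : ℝ, 0 < δ → ∃ c : ℝ, 0 ≤ c ∧ ∀ a, σ a ≤ c * Z a ^ (1 - δ)) :
    ∀ δ : ℝ, 0 < δ → ∃ c : ℝ, 0 ≤ c ∧ ∀ a, σ a ≤ c * Z a ^ (-δ) := by
  intro δ hδ
  obtain ⟨c, hc, h⟩ := h1 δ hδ
  refine ⟨c * max K₀ 0, by positivity, fun a => (h a).trans ?_⟩
  have hsplit : Z a ^ (1 - δ) = Z a * Z a ^ (-δ) := by
    rw [show (1 - δ) = 1 + (-δ) by ring, ← weight_rpow_add hZ, Real.rpow_one]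
  rw [hsplit, ← mul_assoc]
  refine mul_le_mul_of_nonneg_right ?_ (Real.rpow_nonneg (hZ a).le _)
  exact mul_le_mul_of_nonneg_left ((hZK a).trans (le_max_left _ _)) hc

/-- A jet size divided by the weight is tame: `σ ≤ σ₁/Z`, `σ₁ ≤ cZ^{1−δ}` ⟹ `σ ≤ cZ^{−δ}`. [cite: BauerschmidtBodineauDagallier2023, Theorem 3 (proof)] -/
theorem tame_of_jet_div (hZ : ∀ a, 0 < Z a) {σ σ₁ : α → ℝ}
    (h1 : ∀ δ : ℝ, 0 < δ → ∃ c : ℝ, 0 ≤ c ∧ ∀ a, σ₁ a ≤ c * Z a ^ (1 - δ))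
    (h : ∀ a, σ a ≤ σ₁ a / Z a) :
    ∀ δ : ℝ, 0 < δ → ∃ c : ℝ, 0 ≤ c ∧ ∀ a, σ a ≤ c * Z a ^ (-δ) := by
  intro δ hδ
  obtain ⟨c, hc, h1⟩ := h1 δ hδ
  refine ⟨c, hc, fun a => (h a).trans ?_⟩
  rw [div_le_iff₀ (hZ a)]
  have hsplit : c * Z a ^ (-δ) * Z a = c * Z a ^ (1 - δ) := by
    rw [mul_assoc, show (1 - δ) = (-δ) + 1 by ring, ← weight_rpow_add hZ, Real.rpow_one]
  rw [hsplit]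
  exact h1 a

/-- Jet sizes are bounded (`δ = 1`). [cite: BauerschmidtBodineauDagallier2023, Theorem 3 (proof)] -/
theorem bounded_of_jet {σ : α → ℝ}
    (h1 : ∀ δ : ℝ, 0 < δ → ∃ c : ℝ, 0 ≤ c ∧ ∀ a, σ a ≤ c * Z a ^ (1 - δ)) :
    ∃ B : ℝ, 0 ≤ B ∧ ∀ a, σ a ≤ B := by
  obtain ⟨c, hc, h⟩ := h1 1 one_pos
  exact ⟨c, hc, fun a => by simpa [sub_self, Real.rpow_zero] using h a⟩

/-- `Z ·` tame is bounded (`δ = 1`). [cite: BauerschmidtBodineauDagallier2023, Theorem 3 (proof)] -/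
theorem bounded_of_weight_mul_tame (hZ : ∀ a, 0 < Z a) {σ : α → ℝ}
    (h1 : ∀ δ : ℝ, 0 < δ → ∃ c : ℝ, 0 ≤ c ∧ ∀ a, σ a ≤ c * Z a ^ (-δ)) :
    ∃ B : ℝ, 0 ≤ B ∧ ∀ a, Z a * σ a ≤ B := by
  obtain ⟨c, hc, h⟩ := h1 1 one_pos
  refine ⟨c, hc, fun a => ?_⟩
  calc Z a * σ a ≤ Z a * (c * Z a ^ (-(1:ℝ))) := mul_le_mul_of_nonneg_left (h a) (hZ a).le
    _ = c := by
        rw [Real.rpow_neg (hZ a).le, Real.rpow_one]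
        field_simp [(hZ a).ne']

/-- **Tame sizes have arbitrarily small Gaussian growth** when the weight has a Gaussian lower bound:
`σ ≤ c_δ Z^{−δ}` (all `δ`) and `c₁e^{−c₂ q} ≤ Z` with `q ≥ 0` give, for every `r > 0`, `σ ≤ C e^{r q}`.
[cite: BauerschmidtBodineauDagallier2023, Theorem 3 (proof)] -/
theorem exp_bound_of_tame {σ q : α → ℝ} (hq : ∀ a, 0 ≤ q a)
    (h1 : ∀ δ : ℝ, 0 < δ → ∃ c : ℝ, 0 ≤ c ∧ ∀ a, σ a ≤ c * Z a ^ (-δ))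
    {c₁ c₂ : ℝ} (hc₁ : 0 < c₁) (hc₂ : 0 ≤ c₂) (hlow : ∀ a, c₁ * Real.exp (-(c₂ * q a)) ≤ Z a)
    {r : ℝ} (hr : 0 < r) :
    ∃ C : ℝ, 0 ≤ C ∧ ∀ a, σ a ≤ C * Real.exp (r * q a) := by
  set δ : ℝ := r / (c₂ + 1) with hδ
  have hδ0 : 0 < δ := by positivity
  have hδc : δ * c₂ ≤ r := by
    rw [hδ, div_mul_eq_mul_div, div_le_iff₀ (by positivity)]
    nlinarith
  obtain ⟨c, hc, h⟩ := h1 δ hδ0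
  refine ⟨c * c₁ ^ (-δ), by positivity, fun a => (h a).trans ?_⟩
  have hlow' := hlow a
  have hpos : 0 < c₁ * Real.exp (-(c₂ * q a)) := by positivity
  -- `Z^{-δ} ≤ (c₁ e^{-c₂ q})^{-δ} = c₁^{-δ} e^{δ c₂ q} ≤ c₁^{-δ} e^{r q}`
  have h2 : Z a ^ (-δ) ≤ (c₁ * Real.exp (-(c₂ * q a))) ^ (-δ) :=
    Real.rpow_le_rpow_of_nonpos hpos hlow' (by linarith)
  have h3 : (c₁ * Real.exp (-(c₂ * q a))) ^ (-δ) = c₁ ^ (-δ) * Real.exp (δ * c₂ * q a) := by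
    rw [Real.mul_rpow hc₁.le (Real.exp_pos _).le, ← Real.exp_mul]
    ring_nf
  have h4 : Real.exp (δ * c₂ * q a) ≤ Real.exp (r * q a) :=
    Real.exp_le_exp.2 (by nlinarith [hq a])
  rw [mul_assoc]
  refine mul_le_mul_of_nonneg_left ?_ hc
  calc Z a ^ (-δ) ≤ c₁ ^ (-δ) * Real.exp (δ * c₂ * q a) := h2.trans_eq h3
    _ ≤ c₁ ^ (-δ) * Real.exp (r * q a) := mul_le_mul_of_nonneg_left h4 (Real.rpow_nonneg hc₁.le _)

end Size

/-! ### 2. Packs: `HasFDerivAt` chains to second order with jet / tame sizes -/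

section Packs

variable {N : ℕ} {Z : EuclideanSpace ℝ (Fin N) → ℝ} {K₀ : ℝ}
  {f g : EuclideanSpace ℝ (Fin N) → ℝ}
  {f1 g1 : EuclideanSpace ℝ (Fin N) → EuclideanSpace ℝ (Fin N) →L[ℝ] ℝ}
  {f2 g2 : EuclideanSpace ℝ (Fin N) → EuclideanSpace ℝ (Fin N) →L[ℝ] EuclideanSpace ℝ (Fin N) →L[ℝ] ℝ}

/-- The constant pack. [cite: BauerschmidtBodineauDagallier2023, Theorem 3 (proof)] -/
theorem tpack_const_hasFDerivAt (c : ℝ) :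
    (∀ x : EuclideanSpace ℝ (Fin N), HasFDerivAt (fun _ => c) ((fun _ => (0 : EuclideanSpace ℝ (Fin N) →L[ℝ] ℝ)) x) x) ∧
    (∀ x : EuclideanSpace ℝ (Fin N), HasFDerivAt (fun _ => (0 : EuclideanSpace ℝ (Fin N) →L[ℝ] ℝ))
      ((fun _ => (0 : EuclideanSpace ℝ (Fin N) →L[ℝ] EuclideanSpace ℝ (Fin N) →L[ℝ] ℝ)) x) x) :=
  ⟨fun x => hasFDerivAt_const c x, fun x => hasFDerivAt_const _ x⟩

/-- **Sum of tame packs.** [cite: Rudin1976, Thm 5.3] -/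
theorem tpack_add
    (hf : (∀ x, HasFDerivAt f (f1 x) x) ∧ (∀ x, HasFDerivAt f1 (f2 x) x) ∧
      (∀ δ : ℝ, 0 < δ → ∃ c : ℝ, 0 ≤ c ∧ ∀ x, |f x| ≤ c * Z x ^ (-δ)) ∧
      (∀ δ : ℝ, 0 < δ → ∃ c : ℝ, 0 ≤ c ∧ ∀ x, ‖f1 x‖ ≤ c * Z x ^ (-δ)) ∧
      (∀ δ : ℝ, 0 < δ → ∃ c : ℝ, 0 ≤ c ∧ ∀ x, ‖f2 x‖ ≤ c * Z x ^ (-δ)))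
    (hg : (∀ x, HasFDerivAt g (g1 x) x) ∧ (∀ x, HasFDerivAt g1 (g2 x) x) ∧
      (∀ δ : ℝ, 0 < δ → ∃ c : ℝ, 0 ≤ c ∧ ∀ x, |g x| ≤ c * Z x ^ (-δ)) ∧
      (∀ δ : ℝ, 0 < δ → ∃ c : ℝ, 0 ≤ c ∧ ∀ x, ‖g1 x‖ ≤ c * Z x ^ (-δ)) ∧
      (∀ δ : ℝ, 0 < δ → ∃ c : ℝ, 0 ≤ c ∧ ∀ x, ‖g2 x‖ ≤ c * Z x ^ (-δ))) :
    (∀ x, HasFDerivAt (fun x => f x + g x) (f1 x + g1 x) x) ∧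
    (∀ x, HasFDerivAt (fun x => f1 x + g1 x) (f2 x + g2 x) x) ∧
    (∀ δ : ℝ, 0 < δ → ∃ c : ℝ, 0 ≤ c ∧ ∀ x, |f x + g x| ≤ c * Z x ^ (-δ)) ∧
    (∀ δ : ℝ, 0 < δ → ∃ c : ℝ, 0 ≤ c ∧ ∀ x, ‖f1 x + g1 x‖ ≤ c * Z x ^ (-δ)) ∧
    (∀ δ : ℝ, 0 < δ → ∃ c : ℝ, 0 ≤ c ∧ ∀ x, ‖f2 x + g2 x‖ ≤ c * Z x ^ (-δ)) := by
  obtain ⟨hf1, hf2, hf0b, hf1b, hf2b⟩ := hf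
  obtain ⟨hg1, hg2, hg0b, hg1b, hg2b⟩ := hg
  exact ⟨fun x => (hf1 x).add (hg1 x), fun x => (hf2 x).add (hg2 x),
    tame_add hf0b hg0b (fun x => abs_add_le _ _), tame_add hf1b hg1b (fun x => norm_add_le _ _),
    tame_add hf2b hg2b (fun x => norm_add_le _ _)⟩

/-- **Difference of tame packs.** [cite: Rudin1976, Thm 5.3] -/
theorem tpack_sub
    (hf : (∀ x, HasFDerivAt f (f1 x) x) ∧ (∀ x, HasFDerivAt f1 (f2 x) x) ∧
      (∀ δ : ℝ, 0 < δ → ∃ c : ℝ, 0 ≤ c ∧ ∀ x, |f x| ≤ c * Z x ^ (-δ)) ∧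
      (∀ δ : ℝ, 0 < δ → ∃ c : ℝ, 0 ≤ c ∧ ∀ x, ‖f1 x‖ ≤ c * Z x ^ (-δ)) ∧
      (∀ δ : ℝ, 0 < δ → ∃ c : ℝ, 0 ≤ c ∧ ∀ x, ‖f2 x‖ ≤ c * Z x ^ (-δ)))
    (hg : (∀ x, HasFDerivAt g (g1 x) x) ∧ (∀ x, HasFDerivAt g1 (g2 x) x) ∧
      (∀ δ : ℝ, 0 < δ → ∃ c : ℝ, 0 ≤ c ∧ ∀ x, |g x| ≤ c * Z x ^ (-δ)) ∧
      (∀ δ : ℝ, 0 < δ → ∃ c : ℝ, 0 ≤ c ∧ ∀ x, ‖g1 x‖ ≤ c * Z x ^ (-δ)) ∧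
      (∀ δ : ℝ, 0 < δ → ∃ c : ℝ, 0 ≤ c ∧ ∀ x, ‖g2 x‖ ≤ c * Z x ^ (-δ))) :
    (∀ x, HasFDerivAt (fun x => f x - g x) (f1 x - g1 x) x) ∧
    (∀ x, HasFDerivAt (fun x => f1 x - g1 x) (f2 x - g2 x) x) ∧
    (∀ δ : ℝ, 0 < δ → ∃ c : ℝ, 0 ≤ c ∧ ∀ x, |f x - g x| ≤ c * Z x ^ (-δ)) ∧
    (∀ δ : ℝ, 0 < δ → ∃ c : ℝ, 0 ≤ c ∧ ∀ x, ‖f1 x - g1 x‖ ≤ c * Z x ^ (-δ)) ∧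
    (∀ δ : ℝ, 0 < δ → ∃ c : ℝ, 0 ≤ c ∧ ∀ x, ‖f2 x - g2 x‖ ≤ c * Z x ^ (-δ)) := by
  obtain ⟨hf1, hf2, hf0b, hf1b, hf2b⟩ := hf
  obtain ⟨hg1, hg2, hg0b, hg1b, hg2b⟩ := hg
  exact ⟨fun x => (hf1 x).sub (hg1 x), fun x => (hf2 x).sub (hg2 x),
    tame_add hf0b hg0b (fun x => abs_sub _ _), tame_add hf1b hg1b (fun x => norm_sub_le _ _),
    tame_add hf2b hg2b (fun x => norm_sub_le _ _)⟩

/-- **Product of tame packs** (`(fg)″ = f g″ + f′⊗g′ + g f″ + g′⊗f′`). [cite: Rudin1976, Thm 5.3] -/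
theorem tpack_mul (hZ : ∀ x, 0 < Z x)
    (hf : (∀ x, HasFDerivAt f (f1 x) x) ∧ (∀ x, HasFDerivAt f1 (f2 x) x) ∧
      (∀ δ : ℝ, 0 < δ → ∃ c : ℝ, 0 ≤ c ∧ ∀ x, |f x| ≤ c * Z x ^ (-δ)) ∧
      (∀ δ : ℝ, 0 < δ → ∃ c : ℝ, 0 ≤ c ∧ ∀ x, ‖f1 x‖ ≤ c * Z x ^ (-δ)) ∧
      (∀ δ : ℝ, 0 < δ → ∃ c : ℝ, 0 ≤ c ∧ ∀ x, ‖f2 x‖ ≤ c * Z x ^ (-δ)))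
    (hg : (∀ x, HasFDerivAt g (g1 x) x) ∧ (∀ x, HasFDerivAt g1 (g2 x) x) ∧
      (∀ δ : ℝ, 0 < δ → ∃ c : ℝ, 0 ≤ c ∧ ∀ x, |g x| ≤ c * Z x ^ (-δ)) ∧
      (∀ δ : ℝ, 0 < δ → ∃ c : ℝ, 0 ≤ c ∧ ∀ x, ‖g1 x‖ ≤ c * Z x ^ (-δ)) ∧
      (∀ δ : ℝ, 0 < δ → ∃ c : ℝ, 0 ≤ c ∧ ∀ x, ‖g2 x‖ ≤ c * Z x ^ (-δ))) :
    (∀ x, HasFDerivAt (fun x => f x * g x) (f x • g1 x + g x • f1 x) x) ∧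
    (∀ x, HasFDerivAt (fun x => f x • g1 x + g x • f1 x)
      (f x • g2 x + (f1 x).smulRight (g1 x) + (g x • f2 x + (g1 x).smulRight (f1 x))) x) ∧
    (∀ δ : ℝ, 0 < δ → ∃ c : ℝ, 0 ≤ c ∧ ∀ x, |f x * g x| ≤ c * Z x ^ (-δ)) ∧
    (∀ δ : ℝ, 0 < δ → ∃ c : ℝ, 0 ≤ c ∧ ∀ x, ‖f x • g1 x + g x • f1 x‖ ≤ c * Z x ^ (-δ)) ∧
    (∀ δ : ℝ, 0 < δ → ∃ c : ℝ, 0 ≤ c ∧ ∀ x,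
      ‖f x • g2 x + (f1 x).smulRight (g1 x) + (g x • f2 x + (g1 x).smulRight (f1 x))‖ ≤
        c * Z x ^ (-δ)) := by
  obtain ⟨hf1, hf2, hf0b, hf1b, hf2b⟩ := hf
  obtain ⟨hg1, hg2, hg0b, hg1b, hg2b⟩ := hg
  refine ⟨fun x => (hf1 x).mul (hg1 x), fun x => hasFDerivAt_fderiv_mul hf1 hf2 hg1 hg2 x,
    ?_, ?_, ?_⟩
  · exact tame_mul hZ hf0b hg0b (fun x => abs_nonneg _) (fun x => (abs_mul _ _).le)
  · refine tame_add (tame_mul hZ hf0b hg1b (fun x => abs_nonneg _) (fun x => le_rfl))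
      (tame_mul hZ hg0b hf1b (fun x => abs_nonneg _) (fun x => le_rfl)) (fun x => ?_)
    calc ‖f x • g1 x + g x • f1 x‖ ≤ ‖f x • g1 x‖ + ‖g x • f1 x‖ := norm_add_le _ _
      _ = |f x| * ‖g1 x‖ + |g x| * ‖f1 x‖ := by
          rw [norm_smul, norm_smul, Real.norm_eq_abs, Real.norm_eq_abs]
  · refine tame_add
      (tame_add (tame_mul hZ hf0b hg2b (fun x => abs_nonneg _) (fun x => le_rfl))
        (tame_mul hZ hf1b hg1b (fun x => norm_nonneg _) (fun x => le_rfl)) (fun x => le_rfl))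
      (tame_add (tame_mul hZ hg0b hf2b (fun x => abs_nonneg _) (fun x => le_rfl))
        (tame_mul hZ hg1b hf1b (fun x => norm_nonneg _) (fun x => le_rfl)) (fun x => le_rfl))
      (fun x => norm_fderiv₂_mul_le x)

/-- **Jet pack · tame pack is a jet pack.** [cite: Rudin1976, Thm 5.3] -/
theorem jpack_mul_tpack (hZ : ∀ x, 0 < Z x)
    (hf : (∀ x, HasFDerivAt f (f1 x) x) ∧ (∀ x, HasFDerivAt f1 (f2 x) x) ∧
      (∀ δ : ℝ, 0 < δ → ∃ c : ℝ, 0 ≤ c ∧ ∀ x, |f x| ≤ c * Z x ^ (1 - δ)) ∧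
      (∀ δ : ℝ, 0 < δ → ∃ c : ℝ, 0 ≤ c ∧ ∀ x, ‖f1 x‖ ≤ c * Z x ^ (1 - δ)) ∧
      (∀ δ : ℝ, 0 < δ → ∃ c : ℝ, 0 ≤ c ∧ ∀ x, ‖f2 x‖ ≤ c * Z x ^ (1 - δ)))
    (hg : (∀ x, HasFDerivAt g (g1 x) x) ∧ (∀ x, HasFDerivAt g1 (g2 x) x) ∧
      (∀ δ : ℝ, 0 < δ → ∃ c : ℝ, 0 ≤ c ∧ ∀ x, |g x| ≤ c * Z x ^ (-δ)) ∧
      (∀ δ : ℝ, 0 < δ → ∃ c : ℝ, 0 ≤ c ∧ ∀ x, ‖g1 x‖ ≤ c * Z x ^ (-δ)) ∧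
      (∀ δ : ℝ, 0 < δ → ∃ c : ℝ, 0 ≤ c ∧ ∀ x, ‖g2 x‖ ≤ c * Z x ^ (-δ))) :
    (∀ x, HasFDerivAt (fun x => f x * g x) (f x • g1 x + g x • f1 x) x) ∧
    (∀ x, HasFDerivAt (fun x => f x • g1 x + g x • f1 x)
      (f x • g2 x + (f1 x).smulRight (g1 x) + (g x • f2 x + (g1 x).smulRight (f1 x))) x) ∧
    (∀ δ : ℝ, 0 < δ → ∃ c : ℝ, 0 ≤ c ∧ ∀ x, |f x * g x| ≤ c * Z x ^ (1 - δ)) ∧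
    (∀ δ : ℝ, 0 < δ → ∃ c : ℝ, 0 ≤ c ∧ ∀ x, ‖f x • g1 x + g x • f1 x‖ ≤ c * Z x ^ (1 - δ)) ∧
    (∀ δ : ℝ, 0 < δ → ∃ c : ℝ, 0 ≤ c ∧ ∀ x,
      ‖f x • g2 x + (f1 x).smulRight (g1 x) + (g x • f2 x + (g1 x).smulRight (f1 x))‖ ≤
        c * Z x ^ (1 - δ)) := by
  obtain ⟨hf1, hf2, hf0b, hf1b, hf2b⟩ := hf
  obtain ⟨hg1, hg2, hg0b, hg1b, hg2b⟩ := hg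
  refine ⟨fun x => (hf1 x).mul (hg1 x), fun x => hasFDerivAt_fderiv_mul hf1 hf2 hg1 hg2 x,
    ?_, ?_, ?_⟩
  · exact jet_mul_tame hZ hf0b hg0b (fun x => abs_nonneg _) (fun x => (abs_mul _ _).le)
  · refine jet_add (jet_mul_tame hZ hf0b hg1b (fun x => abs_nonneg _) (fun x => le_rfl))
      (tame_mul_jet hZ hg0b hf1b (fun x => abs_nonneg _) (fun x => le_rfl)) (fun x => ?_)
    calc ‖f x • g1 x + g x • f1 x‖ ≤ ‖f x • g1 x‖ + ‖g x • f1 x‖ := norm_add_le _ _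
      _ = |f x| * ‖g1 x‖ + |g x| * ‖f1 x‖ := by
          rw [norm_smul, norm_smul, Real.norm_eq_abs, Real.norm_eq_abs]
  · refine jet_add
      (jet_add (jet_mul_tame hZ hf0b hg2b (fun x => abs_nonneg _) (fun x => le_rfl))
        (jet_mul_tame hZ hf1b hg1b (fun x => norm_nonneg _) (fun x => le_rfl)) (fun x => le_rfl))
      (jet_add (tame_mul_jet hZ hg0b hf2b (fun x => abs_nonneg _) (fun x => le_rfl))
        (tame_mul_jet hZ hg1b hf1b (fun x => norm_nonneg _) (fun x => le_rfl)) (fun x => le_rfl))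
      (fun x => norm_fderiv₂_mul_le x)

/-- The two `HasFDerivAt` identities for the inverse of a positive function:
`D(1/f) = −Df/f²`, `D²(1/f) = −D²f/f² + 2 Df⊗Df/f³`. [cite: Rudin1976, Thm 5.3] -/
theorem hasFDerivAt_inv_pair (hf1 : ∀ x, HasFDerivAt f (f1 x) x) (hf2 : ∀ x, HasFDerivAt f1 (f2 x) x)
    (hpos : ∀ x, 0 < f x) :
    (∀ x, HasFDerivAt (fun x => (f x)⁻¹) (-((f x) ^ 2)⁻¹ • f1 x) x) ∧
    (∀ x, HasFDerivAt (fun x => -((f x) ^ 2)⁻¹ • f1 x)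
      (-((f x) ^ 2)⁻¹ • f2 x + ((2 * ((f x)⁻¹ * ((f x) ^ 2)⁻¹)) • f1 x).smulRight (f1 x)) x) := by
  have hne : ∀ x, f x ≠ 0 := fun x => (hpos x).ne'
  have hne2 : ∀ x, f x ^ 2 ≠ 0 := fun x => pow_ne_zero 2 (hne x)
  have hD1 : ∀ x, HasFDerivAt (fun x => (f x)⁻¹) (-((f x) ^ 2)⁻¹ • f1 x) x := fun x =>
    (hasDerivAt_inv (hne x)).comp_hasFDerivAt x (hf1 x)
  have hc2 : ∀ x, HasFDerivAt (fun x => -((f x) ^ 2)⁻¹) ((2 * ((f x)⁻¹ * ((f x) ^ 2)⁻¹)) • f1 x) x := by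
    intro x
    have hsq : HasFDerivAt (fun x => (f x) ^ 2) ((((2 : ℕ) : ℝ) * f x ^ (2 - 1)) • f1 x) x :=
      (hasDerivAt_pow 2 (f x)).comp_hasFDerivAt x (hf1 x)
    have h := ((hasDerivAt_inv (hne2 x)).comp_hasFDerivAt x hsq).neg
    refine h.congr_fderiv ?_
    rw [smul_smul, ← neg_smul]
    congr 1
    have hZ3 : ((f x ^ 2) ^ 2)⁻¹ * f x = (f x)⁻¹ * (f x ^ 2)⁻¹ := by
      field_simp
    rw [show (2 - 1 : ℕ) = 1 from rfl, pow_one, Nat.cast_ofNat]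
    calc -(-((f x ^ 2) ^ 2)⁻¹ * (2 * f x)) = 2 * (((f x ^ 2) ^ 2)⁻¹ * f x) := by ring
      _ = 2 * ((f x)⁻¹ * (f x ^ 2)⁻¹) := by rw [hZ3]
  exact ⟨hD1, fun x => (hc2 x).smul (hf2 x)⟩

/-- **Inverse of a tame pack bounded below by a positive constant** (e.g. `1/P_{0,t}F` with `P_{0,t}F ≥ a`).
[cite: Rudin1976, Thm 5.3] -/
theorem tpack_inv (hZ : ∀ x, 0 < Z x) (hZK : ∀ x, Z x ≤ K₀)
    (hf : (∀ x, HasFDerivAt f (f1 x) x) ∧ (∀ x, HasFDerivAt f1 (f2 x) x) ∧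
      (∀ δ : ℝ, 0 < δ → ∃ c : ℝ, 0 ≤ c ∧ ∀ x, |f x| ≤ c * Z x ^ (-δ)) ∧
      (∀ δ : ℝ, 0 < δ → ∃ c : ℝ, 0 ≤ c ∧ ∀ x, ‖f1 x‖ ≤ c * Z x ^ (-δ)) ∧
      (∀ δ : ℝ, 0 < δ → ∃ c : ℝ, 0 ≤ c ∧ ∀ x, ‖f2 x‖ ≤ c * Z x ^ (-δ)))
    {m : ℝ} (hm : 0 < m) (hmf : ∀ x, m ≤ f x) :
    (∀ x, HasFDerivAt (fun x => (f x)⁻¹) (-((f x) ^ 2)⁻¹ • f1 x) x) ∧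
    (∀ x, HasFDerivAt (fun x => -((f x) ^ 2)⁻¹ • f1 x)
      (-((f x) ^ 2)⁻¹ • f2 x + ((2 * ((f x)⁻¹ * ((f x) ^ 2)⁻¹)) • f1 x).smulRight (f1 x)) x) ∧
    (∀ δ : ℝ, 0 < δ → ∃ c : ℝ, 0 ≤ c ∧ ∀ x, |(f x)⁻¹| ≤ c * Z x ^ (-δ)) ∧
    (∀ δ : ℝ, 0 < δ → ∃ c : ℝ, 0 ≤ c ∧ ∀ x, ‖-((f x) ^ 2)⁻¹ • f1 x‖ ≤ c * Z x ^ (-δ)) ∧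
    (∀ δ : ℝ, 0 < δ → ∃ c : ℝ, 0 ≤ c ∧ ∀ x,
      ‖-((f x) ^ 2)⁻¹ • f2 x + ((2 * ((f x)⁻¹ * ((f x) ^ 2)⁻¹)) • f1 x).smulRight (f1 x)‖ ≤
        c * Z x ^ (-δ)) := by
  obtain ⟨hf1, hf2, hf0b, hf1b, hf2b⟩ := hf
  have hpos : ∀ x, 0 < f x := fun x => hm.trans_le (hmf x)
  obtain ⟨hD1, hD2⟩ := hasFDerivAt_inv_pair hf1 hf2 hpos
  -- bounds on the scalar factors
  have hb0 : ∀ x, |(f x)⁻¹| ≤ m⁻¹ := fun x => by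
    rw [abs_inv, abs_of_pos (hpos x)]; exact inv_anti₀ hm (hmf x)
  have hb1 : ∀ x, |((f x) ^ 2)⁻¹| ≤ (m ^ 2)⁻¹ := fun x => by
    rw [abs_inv, abs_of_pos (pow_pos (hpos x) 2)]
    exact inv_anti₀ (pow_pos hm 2) (pow_le_pow_left₀ hm.le (hmf x) 2)
  have hb3 : ∀ x, |2 * ((f x)⁻¹ * ((f x) ^ 2)⁻¹)| ≤ 2 * (m⁻¹ * (m ^ 2)⁻¹) := fun x => by
    rw [abs_mul, abs_mul, abs_of_pos (by norm_num : (0:ℝ) < 2)]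
    exact mul_le_mul_of_nonneg_left (mul_le_mul (hb0 x) (hb1 x) (abs_nonneg _) (by positivity))
      (by norm_num)
  have t0 := tame_of_le_const hZ hZK hb0
  have t1 := tame_of_le_const hZ hZK hb1
  have t3 := tame_of_le_const hZ hZK hb3
  refine ⟨hD1, hD2, t0, ?_, ?_⟩
  · refine tame_mul hZ t1 hf1b (fun x => abs_nonneg _) (fun x => ?_)
    rw [norm_smul, Real.norm_eq_abs, abs_neg]
  · refine tame_add (tame_mul hZ t1 hf2b (fun x => abs_nonneg _) (fun x => le_rfl))
      (tame_mul hZ (tame_mul hZ t3 hf1b (fun x => abs_nonneg _) (fun x => le_rfl)) hf1b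
        (fun x => by positivity) (fun x => le_rfl)) (fun x => ?_)
    calc _ ≤ ‖-((f x) ^ 2)⁻¹ • f2 x‖ + ‖((2 * ((f x)⁻¹ * ((f x) ^ 2)⁻¹)) • f1 x).smulRight (f1 x)‖ :=
          norm_add_le _ _
      _ = |((f x) ^ 2)⁻¹| * ‖f2 x‖ + |2 * ((f x)⁻¹ * ((f x) ^ 2)⁻¹)| * ‖f1 x‖ * ‖f1 x‖ := by
          rw [norm_smul, Real.norm_eq_abs, abs_neg, ContinuousLinearMap.norm_smulRight_apply, norm_smul,
            Real.norm_eq_abs]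

/-- **The quotient jet / weight is tame**: for the weight `Z` itself carrying a jet pack `(Z, Z1, Z2)` and
a jet pack `(f, f1, f2)`, the function `f/Z = f · Z⁻¹` carries a tame pack (`P_{0,t}F = W_t/Z_t` and the
normalised jets `∂Z_t/Z_t`, … of [BBD]'s proof, without a lower bound on `Z_t`).
[cite: BauerschmidtBodineauDagallier2023, Proposition 8 (proof)] -/
theorem tpack_of_jpack_div (hZ : ∀ x, 0 < Z x)
    {Z1 : EuclideanSpace ℝ (Fin N) → EuclideanSpace ℝ (Fin N) →L[ℝ] ℝ}
    {Z2 : EuclideanSpace ℝ (Fin N) → EuclideanSpace ℝ (Fin N) →L[ℝ] EuclideanSpace ℝ (Fin N) →L[ℝ] ℝ}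
    (hZp : (∀ x, HasFDerivAt Z (Z1 x) x) ∧ (∀ x, HasFDerivAt Z1 (Z2 x) x) ∧
      (∀ δ : ℝ, 0 < δ → ∃ c : ℝ, 0 ≤ c ∧ ∀ x, ‖Z1 x‖ ≤ c * Z x ^ (1 - δ)) ∧
      (∀ δ : ℝ, 0 < δ → ∃ c : ℝ, 0 ≤ c ∧ ∀ x, ‖Z2 x‖ ≤ c * Z x ^ (1 - δ)))
    (hf : (∀ x, HasFDerivAt f (f1 x) x) ∧ (∀ x, HasFDerivAt f1 (f2 x) x) ∧
      (∀ δ : ℝ, 0 < δ → ∃ c : ℝ, 0 ≤ c ∧ ∀ x, |f x| ≤ c * Z x ^ (1 - δ)) ∧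
      (∀ δ : ℝ, 0 < δ → ∃ c : ℝ, 0 ≤ c ∧ ∀ x, ‖f1 x‖ ≤ c * Z x ^ (1 - δ)) ∧
      (∀ δ : ℝ, 0 < δ → ∃ c : ℝ, 0 ≤ c ∧ ∀ x, ‖f2 x‖ ≤ c * Z x ^ (1 - δ))) :
    (∀ x, HasFDerivAt (fun x => f x * (Z x)⁻¹) (f x • (-((Z x) ^ 2)⁻¹ • Z1 x) + (Z x)⁻¹ • f1 x) x) ∧
    (∀ x, HasFDerivAt (fun x => f x • (-((Z x) ^ 2)⁻¹ • Z1 x) + (Z x)⁻¹ • f1 x)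
      (f x • (-((Z x) ^ 2)⁻¹ • Z2 x + ((2 * ((Z x)⁻¹ * ((Z x) ^ 2)⁻¹)) • Z1 x).smulRight (Z1 x)) +
        (f1 x).smulRight (-((Z x) ^ 2)⁻¹ • Z1 x) +
        ((Z x)⁻¹ • f2 x + (-((Z x) ^ 2)⁻¹ • Z1 x).smulRight (f1 x))) x) ∧
    (∀ δ : ℝ, 0 < δ → ∃ c : ℝ, 0 ≤ c ∧ ∀ x, |f x * (Z x)⁻¹| ≤ c * Z x ^ (-δ)) ∧
    (∀ δ : ℝ, 0 < δ → ∃ c : ℝ, 0 ≤ c ∧ ∀ x,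
      ‖f x • (-((Z x) ^ 2)⁻¹ • Z1 x) + (Z x)⁻¹ • f1 x‖ ≤ c * Z x ^ (-δ)) ∧
    (∀ δ : ℝ, 0 < δ → ∃ c : ℝ, 0 ≤ c ∧ ∀ x,
      ‖f x • (-((Z x) ^ 2)⁻¹ • Z2 x + ((2 * ((Z x)⁻¹ * ((Z x) ^ 2)⁻¹)) • Z1 x).smulRight (Z1 x)) +
        (f1 x).smulRight (-((Z x) ^ 2)⁻¹ • Z1 x) +
        ((Z x)⁻¹ • f2 x + (-((Z x) ^ 2)⁻¹ • Z1 x).smulRight (f1 x))‖ ≤ c * Z x ^ (-δ)) := by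
  obtain ⟨hZ1, hZ2, hZ1b, hZ2b⟩ := hZp
  obtain ⟨hf1, hf2, hf0b, hf1b, hf2b⟩ := hf
  obtain ⟨hI1, hI2⟩ := hasFDerivAt_inv_pair hZ1 hZ2 hZ
  -- the tame sizes of the normalised jets
  have nf0 : ∀ δ : ℝ, 0 < δ → ∃ c : ℝ, 0 ≤ c ∧ ∀ x, |f x| / Z x ≤ c * Z x ^ (-δ) :=
    tame_of_jet_div hZ hf0b (fun x => le_rfl)
  have nf1 : ∀ δ : ℝ, 0 < δ → ∃ c : ℝ, 0 ≤ c ∧ ∀ x, ‖f1 x‖ / Z x ≤ c * Z x ^ (-δ) :=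
    tame_of_jet_div hZ hf1b (fun x => le_rfl)
  have nf2 : ∀ δ : ℝ, 0 < δ → ∃ c : ℝ, 0 ≤ c ∧ ∀ x, ‖f2 x‖ / Z x ≤ c * Z x ^ (-δ) :=
    tame_of_jet_div hZ hf2b (fun x => le_rfl)
  have nZ1 : ∀ δ : ℝ, 0 < δ → ∃ c : ℝ, 0 ≤ c ∧ ∀ x, ‖Z1 x‖ / Z x ≤ c * Z x ^ (-δ) :=
    tame_of_jet_div hZ hZ1b (fun x => le_rfl)
  have nZ2 : ∀ δ : ℝ, 0 < δ → ∃ c : ℝ, 0 ≤ c ∧ ∀ x, ‖Z2 x‖ / Z x ≤ c * Z x ^ (-δ) :=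
    tame_of_jet_div hZ hZ2b (fun x => le_rfl)
  have hZne : ∀ x, Z x ≠ 0 := fun x => (hZ x).ne'
  refine ⟨fun x => (hf1 x).mul (hI1 x), fun x => hasFDerivAt_fderiv_mul hf1 hf2 hI1 hI2 x, ?_, ?_, ?_⟩
  · -- `|f/Z|`
    refine tame_mono nf0 (fun x => ?_)
    rw [abs_mul, abs_inv, abs_of_pos (hZ x), ← div_eq_mul_inv]
  · -- `‖f•(−Z1/Z²) + f1/Z‖ ≤ (|f|/Z)(‖Z1‖/Z) + ‖f1‖/Z`
    refine tame_add (tame_mul hZ nf0 nZ1 (fun x => div_nonneg (abs_nonneg _) (hZ x).le)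
      (fun x => le_rfl)) nf1 (fun x => ?_)
    calc _ ≤ ‖f x • (-((Z x) ^ 2)⁻¹ • Z1 x)‖ + ‖(Z x)⁻¹ • f1 x‖ := norm_add_le _ _
      _ = |f x| / Z x * (‖Z1 x‖ / Z x) + ‖f1 x‖ / Z x := by
          rw [norm_smul, norm_smul, norm_smul, Real.norm_eq_abs, Real.norm_eq_abs, Real.norm_eq_abs,
            abs_neg, abs_inv, abs_inv, abs_of_pos (hZ x), abs_of_pos (pow_pos (hZ x) 2)]
          field_simp
  · -- second derivative: four groups
    have hA : ∀ δ : ℝ, 0 < δ → ∃ c : ℝ, 0 ≤ c ∧ ∀ x,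
        ‖f x • (-((Z x) ^ 2)⁻¹ • Z2 x + ((2 * ((Z x)⁻¹ * ((Z x) ^ 2)⁻¹)) • Z1 x).smulRight (Z1 x))‖ ≤
          c * Z x ^ (-δ) := by
      have nZ1two : ∀ δ : ℝ, 0 < δ → ∃ c : ℝ, 0 ≤ c ∧ ∀ x, ‖Z1 x‖ / Z x * 2 ≤ c * Z x ^ (-δ) :=
        tame_add nZ1 nZ1 (fun x => by linarith)
      refine tame_add
        (tame_mul hZ nf0 nZ2 (fun x => div_nonneg (abs_nonneg _) (hZ x).le) (fun x => le_rfl))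
        (tame_mul hZ (tame_mul hZ nf0 nZ1 (fun x => div_nonneg (abs_nonneg _) (hZ x).le)
          (fun x => le_rfl)) nZ1two (fun x => mul_nonneg (div_nonneg (abs_nonneg _) (hZ x).le)
            (div_nonneg (norm_nonneg _) (hZ x).le)) (fun x => le_rfl)) (fun x => ?_)
      rw [norm_smul, Real.norm_eq_abs]
      have h1 : ‖-((Z x) ^ 2)⁻¹ • Z2 x + ((2 * ((Z x)⁻¹ * ((Z x) ^ 2)⁻¹)) • Z1 x).smulRight (Z1 x)‖ ≤
          ((Z x) ^ 2)⁻¹ * ‖Z2 x‖ + 2 * ((Z x)⁻¹ * ((Z x) ^ 2)⁻¹) * ‖Z1 x‖ * ‖Z1 x‖ := by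
        calc _ ≤ ‖-((Z x) ^ 2)⁻¹ • Z2 x‖ + ‖((2 * ((Z x)⁻¹ * ((Z x) ^ 2)⁻¹)) • Z1 x).smulRight (Z1 x)‖ :=
              norm_add_le _ _
          _ = _ := by
              have hzx := hZ x
              rw [norm_smul, Real.norm_eq_abs, abs_neg, abs_inv, abs_of_pos (pow_pos hzx 2),
                ContinuousLinearMap.norm_smulRight_apply, norm_smul, Real.norm_eq_abs,
                abs_of_pos (by positivity : (0:ℝ) < 2 * ((Z x)⁻¹ * ((Z x) ^ 2)⁻¹))]
      calc |f x| * ‖-((Z x) ^ 2)⁻¹ • Z2 x + ((2 * ((Z x)⁻¹ * ((Z x) ^ 2)⁻¹)) • Z1 x).smulRight (Z1 x)‖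
          ≤ |f x| * (((Z x) ^ 2)⁻¹ * ‖Z2 x‖ + 2 * ((Z x)⁻¹ * ((Z x) ^ 2)⁻¹) * ‖Z1 x‖ * ‖Z1 x‖) :=
            mul_le_mul_of_nonneg_left h1 (abs_nonneg _)
        _ = |f x| / Z x * (‖Z2 x‖ / Z x) + |f x| / Z x * (‖Z1 x‖ / Z x) * (‖Z1 x‖ / Z x * 2) := by
            field_simp
    -- NB: the factor `2` is absorbed by doubling the tame bound
    have hA' : ∀ δ : ℝ, 0 < δ → ∃ c : ℝ, 0 ≤ c ∧ ∀ x,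
        ‖f x • (-((Z x) ^ 2)⁻¹ • Z2 x + ((2 * ((Z x)⁻¹ * ((Z x) ^ 2)⁻¹)) • Z1 x).smulRight (Z1 x))‖ ≤
          c * Z x ^ (-δ) := hA
    have hB : ∀ δ : ℝ, 0 < δ → ∃ c : ℝ, 0 ≤ c ∧ ∀ x,
        ‖(f1 x).smulRight (-((Z x) ^ 2)⁻¹ • Z1 x)‖ ≤ c * Z x ^ (-δ) := by
      refine tame_mul hZ nf1 nZ1 (fun x => div_nonneg (norm_nonneg _) (hZ x).le) (fun x => ?_)
      rw [ContinuousLinearMap.norm_smulRight_apply, norm_smul, Real.norm_eq_abs, abs_neg, abs_inv,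
        abs_of_pos (pow_pos (hZ x) 2)]
      apply le_of_eq; field_simp
    have hC : ∀ δ : ℝ, 0 < δ → ∃ c : ℝ, 0 ≤ c ∧ ∀ x, ‖(Z x)⁻¹ • f2 x‖ ≤ c * Z x ^ (-δ) := by
      refine tame_mono nf2 (fun x => ?_)
      rw [norm_smul, Real.norm_eq_abs, abs_inv, abs_of_pos (hZ x), ← div_eq_inv_mul]
    have hD : ∀ δ : ℝ, 0 < δ → ∃ c : ℝ, 0 ≤ c ∧ ∀ x,
        ‖(-((Z x) ^ 2)⁻¹ • Z1 x).smulRight (f1 x)‖ ≤ c * Z x ^ (-δ) := by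
      refine tame_mul hZ nZ1 nf1 (fun x => div_nonneg (norm_nonneg _) (hZ x).le) (fun x => ?_)
      rw [ContinuousLinearMap.norm_smulRight_apply, norm_smul, Real.norm_eq_abs, abs_neg, abs_inv,
        abs_of_pos (pow_pos (hZ x) 2)]
      apply le_of_eq; field_simp
    exact tame_add (tame_add hA' hB (fun x => norm_add_le _ _)) (tame_add hC hD (fun x => norm_add_le _ _))
      (fun x => norm_add_le _ _)

/-- **Composition of a tame pack with a `C_b²` scalar function** (`Φ ∘ P_{0,t}F` in [BBD]'s proof of
Theorem 3): `D(Φ∘u) = Φ′(u) Du`, `D²(Φ∘u) = Φ′(u) D²u + Φ″(u) Du⊗Du`.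
[cite: BauerschmidtBodineauDagallier2023, Theorem 3 (proof)] -/
theorem tpack_comp (hZ : ∀ x, 0 < Z x) (hZK : ∀ x, Z x ≤ K₀) {u : EuclideanSpace ℝ (Fin N) → ℝ}
    {u1 : EuclideanSpace ℝ (Fin N) → EuclideanSpace ℝ (Fin N) →L[ℝ] ℝ}
    {u2 : EuclideanSpace ℝ (Fin N) → EuclideanSpace ℝ (Fin N) →L[ℝ] EuclideanSpace ℝ (Fin N) →L[ℝ] ℝ}
    (hu : (∀ x, HasFDerivAt u (u1 x) x) ∧ (∀ x, HasFDerivAt u1 (u2 x) x) ∧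
      (∀ δ : ℝ, 0 < δ → ∃ c : ℝ, 0 ≤ c ∧ ∀ x, |u x| ≤ c * Z x ^ (-δ)) ∧
      (∀ δ : ℝ, 0 < δ → ∃ c : ℝ, 0 ≤ c ∧ ∀ x, ‖u1 x‖ ≤ c * Z x ^ (-δ)) ∧
      (∀ δ : ℝ, 0 < δ → ∃ c : ℝ, 0 ≤ c ∧ ∀ x, ‖u2 x‖ ≤ c * Z x ^ (-δ)))
    {Φ Φ' Φ'' : ℝ → ℝ} (hΦ1 : ∀ r, HasDerivAt Φ (Φ' r) r) (hΦ2 : ∀ r, HasDerivAt Φ' (Φ'' r) r)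
    {P0 P1 P2 : ℝ} (hP0 : ∀ r, |Φ r| ≤ P0) (hP1 : ∀ r, |Φ' r| ≤ P1) (hP2 : ∀ r, |Φ'' r| ≤ P2) :
    (∀ x, HasFDerivAt (fun x => Φ (u x)) (Φ' (u x) • u1 x) x) ∧
    (∀ x, HasFDerivAt (fun x => Φ' (u x) • u1 x)
      (Φ' (u x) • u2 x + (Φ'' (u x) • u1 x).smulRight (u1 x)) x) ∧
    (∀ δ : ℝ, 0 < δ → ∃ c : ℝ, 0 ≤ c ∧ ∀ x, |Φ (u x)| ≤ c * Z x ^ (-δ)) ∧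
    (∀ δ : ℝ, 0 < δ → ∃ c : ℝ, 0 ≤ c ∧ ∀ x, ‖Φ' (u x) • u1 x‖ ≤ c * Z x ^ (-δ)) ∧
    (∀ δ : ℝ, 0 < δ → ∃ c : ℝ, 0 ≤ c ∧ ∀ x,
      ‖Φ' (u x) • u2 x + (Φ'' (u x) • u1 x).smulRight (u1 x)‖ ≤ c * Z x ^ (-δ)) := by
  obtain ⟨hu1, hu2, hu0b, hu1b, hu2b⟩ := hu
  have t0 := tame_of_le_const hZ hZK (fun x => hP0 (u x))
  have t1 := tame_of_le_const hZ hZK (fun x => hP1 (u x))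
  have t2 := tame_of_le_const hZ hZK (fun x => hP2 (u x))
  refine ⟨fun x => (hΦ1 (u x)).comp_hasFDerivAt x (hu1 x), fun x => ?_, t0, ?_, ?_⟩
  · have hc : HasFDerivAt (fun x => Φ' (u x)) (Φ'' (u x) • u1 x) x :=
      (hΦ2 (u x)).comp_hasFDerivAt x (hu1 x)
    exact hc.smul (hu2 x)
  · refine tame_mul hZ t1 hu1b (fun x => abs_nonneg _) (fun x => ?_)
    rw [norm_smul, Real.norm_eq_abs]
  · refine tame_add (tame_mul hZ t1 hu2b (fun x => abs_nonneg _) (fun x => le_rfl))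
      (tame_mul hZ (tame_mul hZ t2 hu1b (fun x => abs_nonneg _) (fun x => le_rfl)) hu1b
        (fun x => by positivity) (fun x => le_rfl)) (fun x => ?_)
    calc _ ≤ ‖Φ' (u x) • u2 x‖ + ‖(Φ'' (u x) • u1 x).smulRight (u1 x)‖ := norm_add_le _ _
      _ = |Φ' (u x)| * ‖u2 x‖ + |Φ'' (u x)| * ‖u1 x‖ * ‖u1 x‖ := by
          rw [norm_smul, Real.norm_eq_abs, ContinuousLinearMap.norm_smulRight_apply, norm_smul,
            Real.norm_eq_abs]

/-- **Uniform continuity of a bilinear-map-valued function from Lipschitz matrix elements**: if each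
`x ↦ B(x)(e_i, e_j)` has a Fréchet derivative bounded by `L`, then `B` is uniformly continuous (the
operator norm is dominated by the sum of the absolute matrix elements). [cite: BauerschmidtBodineauDagallier2023, Theorem 3 (proof)] -/
theorem uniformContinuous_of_matrix_elements
    {B : EuclideanSpace ℝ (Fin N) → EuclideanSpace ℝ (Fin N) →L[ℝ] EuclideanSpace ℝ (Fin N) →L[ℝ] ℝ}
    {DB : Fin N → Fin N → EuclideanSpace ℝ (Fin N) → EuclideanSpace ℝ (Fin N) →L[ℝ] ℝ}
    (hB : ∀ i j x, HasFDerivAt (fun x => B x (EuclideanSpace.single i 1) (EuclideanSpace.single j 1))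
      (DB i j x) x)
    {L : ℝ} (hL : ∀ i j x, ‖DB i j x‖ ≤ L) : UniformContinuous B := by
  classical
  have hel : ∀ i j, UniformContinuous
      (fun x => B x (EuclideanSpace.single i 1) (EuclideanSpace.single j 1)) :=
    fun i j => uc_of_hasFDerivAt_bound (hB i j) (hL i j)
  rw [Metric.uniformContinuous_iff]
  intro ε hε
  set CN : ℝ := ∑ _i : Fin N, ∑ _j : Fin N, (1:ℝ) with hCN
  have hCN0 : 0 ≤ CN := by positivity
  set ε' : ℝ := ε / (2 * (CN + 1)) with hε'
  have hε'0 : 0 < ε' := by positivity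
  have hδij : ∀ i j, ∃ δ > 0, ∀ x y : EuclideanSpace ℝ (Fin N), dist x y < δ →
      dist (B x (EuclideanSpace.single i 1) (EuclideanSpace.single j 1))
        (B y (EuclideanSpace.single i 1) (EuclideanSpace.single j 1)) < ε' :=
    fun i j => Metric.uniformContinuous_iff.mp (hel i j) ε' hε'0
  choose δ hδ hδB using hδij
  -- a common modulus `δ₀ ≤ δ i j`
  set δ₀ : ℝ := ((∑ i, ∑ j, (δ i j)⁻¹) + 1)⁻¹ with hδ₀
  have hS0 : 0 ≤ ∑ i, ∑ j, (δ i j)⁻¹ :=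
    Finset.sum_nonneg fun i _ => Finset.sum_nonneg fun j _ => (inv_pos.2 (hδ i j)).le
  have hδ₀pos : 0 < δ₀ := by rw [hδ₀]; positivity
  have hδ₀le : ∀ i j, δ₀ ≤ δ i j := by
    intro i j
    have h1 : (δ i j)⁻¹ ≤ (∑ i, ∑ j, (δ i j)⁻¹) + 1 := by
      have h2 : (δ i j)⁻¹ ≤ ∑ j', (δ i j')⁻¹ :=
        Finset.single_le_sum (f := fun j' => (δ i j')⁻¹) (fun _ _ => (inv_pos.2 (hδ i _)).le)
          (Finset.mem_univ j)
      have h3 : (∑ j', (δ i j')⁻¹) ≤ ∑ i', ∑ j', (δ i' j')⁻¹ :=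
        Finset.single_le_sum (f := fun i' => ∑ j', (δ i' j')⁻¹)
          (fun _ _ => Finset.sum_nonneg fun _ _ => (inv_pos.2 (hδ _ _)).le) (Finset.mem_univ i)
      linarith
    rw [hδ₀]
    calc ((∑ i, ∑ j, (δ i j)⁻¹) + 1)⁻¹ ≤ ((δ i j)⁻¹)⁻¹ := inv_anti₀ (inv_pos.2 (hδ i j)) h1
      _ = δ i j := inv_inv _
  refine ⟨δ₀, hδ₀pos, fun {x y} hxy => ?_⟩
  rw [dist_eq_norm]
  have hle : ∀ i j, |(B x - B y) (EuclideanSpace.single i 1) (EuclideanSpace.single j 1)| ≤ ε' := by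
    intro i j
    have hd : dist x y < δ i j := lt_of_lt_of_le hxy (hδ₀le i j)
    have h := hδB i j x y hd
    rw [Real.dist_eq] at h
    rw [_root_.sub_apply, _root_.sub_apply]
    exact h.le
  have hsum : (∑ _i : Fin N, ∑ _j : Fin N, ε') = CN * ε' := by
    rw [hCN]
    simp only [Finset.sum_const, Finset.card_univ, Fintype.card_fin]
    ring
  calc ‖B x - B y‖ ≤ ∑ i, ∑ j, |(B x - B y) (EuclideanSpace.single i 1) (EuclideanSpace.single j 1)| :=
        opNorm₂_le_sum_abs_apply_single _
    _ ≤ ∑ _i : Fin N, ∑ _j : Fin N, ε' := Finset.sum_le_sum fun i _ => Finset.sum_le_sum fun j _ => hle i j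
    _ = CN * ε' := hsum
    _ < ε := by
        rw [hε']
        have h1 : CN * (ε / (2 * (CN + 1))) = ε * (CN / (2 * (CN + 1))) := by ring
        rw [h1]
        have h2 : CN / (2 * (CN + 1)) < 1 := by
          rw [div_lt_one (by positivity)]; linarith
        calc ε * (CN / (2 * (CN + 1))) < ε * 1 := mul_lt_mul_of_pos_left h2 hε
          _ = ε := mul_one _

end Packs

end Polchinski

end Literature.Analysis.FunctionSpaces

end
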